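import Literature.AlgebraicGeometry.HodgeTheory.GysinKernelSplitBirationalTransfer
import Literature.AlgebraicGeometry.HodgeTheory.ComplexGysin
import Literature.AlgebraicTopology.SingularHomology.ExcisionTheorem
import Literature.AlgebraicTopology.SingularHomology.CohomologyDisjointOpenCover
import Literature.AlgebraicTopology.SingularHomology.TripleSequence
import HarnessLib

/-!
# The cohomology of a proper modification is spanned by the pull-back and the classes supported on
# the exceptional locus; Thom–Gysin exactness for finitely many DISJOINT smooth closed subvarieties

Topic `Literature/AlgebraicGeometry/HodgeTheory`. PROOF FILE (theorems only; no definition, no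
named fact — D-0026). Two topological inputs of the blow-up formula (C. Voisin, *Hodge Theory and
Complex Algebraic Geometry I*, Thm. 7.31: for the blow-up `τ : X̃_Z → X` of a compact complex manifold
along a submanifold `Z` of codimension `r`, with exceptional divisor `j : E = ℙ(N_{Z/X}) ↪ X̃_Z`,
`Hᵏ(X) ⊕ ⊕_{0 ≤ i ≤ r-2} H^{k-2i-2}(Z) ≅ Hᵏ(X̃_Z)` through `τ^*` and `j_* ∘ (hⁱ ∪ ·) ∘ τ_E^*`;
T. Shioda, T. Katsura, Tôhoku Math. J. 31 (1979), Lemma 2.1), in the generality of a proper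
modification and in SPANNING form, on the tree's real carriers `complexBetti = H*(–(ℂ); ℂ)`:

* `exists_restrictCompl_sub_map_eq_zero_of_isIso_restrict` — **the pure part of the open piece is
  reached from the base**: for `b : Z ⟶ M` a birational morphism of smooth projective complex
  `n`-folds which is an isomorphism over the open `U ⊆ M`, every `z ∈ Hᵏ(Z(ℂ); ℂ)` differs from a
  pulled-back class `b^* y` by a class dying on `(b⁻¹U)(ℂ)`. Printed argument (Voisin I, proof of
  Thm. 7.31, first step: "`τ^*` is injective … `τ_* ∘ τ^* = id`", with Fulton, *Intersection Theory*,
  Lemma 19.1.2 for the degree): `b` has degree one (the tree's `exists_hasDegree_one_of_isBirational`),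
  so `w = z - b^*(b_! z)` has `b_! w = 0` (projection formula `b_! b^* = id`,
  `gysinMap_map_of_hasDegree`); and **a class `w` with `b_! w = 0` dies on `(b⁻¹U)(ℂ)`**
  (`map_subsetIncl_compl_eq_zero_of_gysinMap_eq_zero`): over a field a class dies on the open
  `Ũ = (b⁻¹U)(ℂ)` iff `w ⌢ [Z]` maps to `0` in `H_q(Z, Z ∖ C)` for every closed `C ⊆ Ũ` (the tree's
  `map_eq_zero_iff_forall_ofAbsolute_capProduct_eq_zero`, Čech–Poincaré duality), and
  `H_q(Z(ℂ), Z(ℂ) ∖ C) → H_q(M(ℂ), M(ℂ) ∖ b(C))` is an ISOMORPHISM (excision around `C`, `b` being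
  a homeomorphism of `Ũ` onto the open `U(ℂ)`; `relativeSingularHomology.isIso_map_of_isOpenEmbedding`)
  carrying `j_*(w ⌢ [Z])` to `j_*(b_*(w ⌢ [Z])) = j_*(b_! w ⌢ [M]) = 0` (`capProduct_gysinMap`).
* `ker_restrictCompl_eq_iSup_range_complexGysin_of_disjoint` — **Thom–Gysin exactness for finitely
  many pairwise DISJOINT smooth closed subvarieties** `jₜ : Eₜ ⟶ Z`:
  `ker (Hᵇ(Z(ℂ)) → Hᵇ((Z ∖ ⋃ₜ jₜ(Eₜ))(ℂ))) = Σₜ im (jₜ)_*` — Deligne's Cor. 8.2.8 for this family,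
  unconditionally: the Čech hypothesis of the tree's `ker_restrictCompl_eq_iSup_range_complexGysin_of_pullback`
  holds component by component (`exists_isOpen_map_subsetIncl_eq_zero_of_isClosedImmersion`,
  tautness of compact submanifolds) on pairwise disjoint open neighbourhoods, over whose union a
  class vanishing on each piece vanishes (additivity of cohomology over a disjoint open
  decomposition, `eq_zero_of_forall_map_subsetIncl_eq_zero`).
* `mem_range_map_sup_iSup_range_complexGysin_of_isIso_restrict` — **the two combined**: if
  moreover `Z ∖ b⁻¹U = ⋃ₜ jₜ(Eₜ)`, then
  `Hᵏ(Z(ℂ); ℂ) = b^* Hᵏ(M(ℂ); ℂ) + Σₜ (jₜ)_* H^{k - 2cₜ}(Eₜ(ℂ); ℂ)` — the spanning half of the blow-up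
  formula with the exceptional divisor left undecomposed (its cohomology, that of a projective bundle
  over the centre, is the remaining input of Thm. 7.31 / Lemma 2.1).

## References

* [VoisinHodgeI2002] C. Voisin, Hodge Theory and Complex Algebraic Geometry I, CUP 2002, Thm. 7.31
  (proof), Lemma 7.28, §7.3.3.
* [ShiodaKatsura1979] T. Shioda, T. Katsura, On Fermat varieties, Tôhoku Math. J. 31 (1979), Lemma 2.1.
* [Fulton1998] W. Fulton, Intersection Theory, 2nd ed. (1998), Lemma 19.1.2, §6.7.
* [HatcherAT2002] A. Hatcher, Algebraic Topology, CUP 2002, Thm. 2.20 (excision), §3.1 p. 202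
  (additivity), §3.3 Thm. 3.44.
* [DeligneHodgeIII1974] P. Deligne, Théorie de Hodge III, Publ. Math. IHÉS 44 (1974), Cor. 8.2.8.
* [Spanier1981] E. H. Spanier, Algebraic Topology, Ch. 6 §1 Thm. 10 (tautness).
-/

noncomputable section

open CategoryTheory Set Topology AlgebraicGeometry Function
open Literature.AlgebraicTopology.SingularHomology

universe u v

/-! ### Topological part: excision around a closed set along an open embedding; a class killed by
the Gysin map of a map which is a homeomorphism near the set dies there -/

namespace Literature.AlgebraicTopology.SingularHomology

section Excision

variable (R : Type v) [CommRing R] (Md : Type v) [AddCommGroup Md] [Module R Md]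
variable {X Y : Type u} [TopologicalSpace X] [TopologicalSpace Y]

omit [TopologicalSpace X] [TopologicalSpace Y] in
/-- An injective map is a map of pairs `(X, X ∖ C) → (Y, Y ∖ f(C))`. [folklore] -/
lemma mapsTo_compl_image_of_injective {f : X → Y} (hf : Function.Injective f) (C : Set X) :
    MapsTo f Cᶜ (f '' C)ᶜ :=
  fun _ hx ⟨_, hc, e⟩ ↦ hx (hf e ▸ hc)

/-- **Excision around a closed set along an open embedding** (Hatcher 2002, Thm. 2.20 with §3.3
p. 231): for an open embedding `f : X → Y` and `C ⊆ X` with `f(C)` closed in `Y`, the map of pairs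
`(X, X ∖ C) → (Y, Y ∖ f(C))` induces isomorphisms `Hₖ(X, X ∖ C; M) ≅ Hₖ(Y, Y ∖ f(C); M)`: `f` is
a homeomorphism onto the open `f(X)` followed by the inclusion `(f(X), f(X) ∖ f(C)) ↪ (Y, Y ∖ f(C))`,
an excision (`Y ∖ f(C)` and `f(X)` are open and cover `Y`). The set form of the tree's
`localHomology.isIso_map_of_isOpenEmbedding_of_eq`. [cite: HatcherAT2002, Thm. 2.20 and §3.3 p. 231] -/
theorem relativeSingularHomology.isIso_map_of_isOpenEmbedding (f : C(X, Y)) (hf : IsOpenEmbedding f)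
    {C : Set X} (hC : IsClosed (f '' C)) (k : ℕ) :
    IsIso (relativeSingularHomology.map R Md f (mapsTo_compl_image_of_injective hf.injective C) k) := by
  let e : X ≃ₜ ↥(range f) := hf.isEmbedding.toHomeomorph
  have hfac : f = (subsetIncl (range f)).comp (e : C(X, ↥(range f))) := by
    ext x
    rfl
  have hev : ∀ x, ((e x : ↥(range f)) : Y) = f x := fun _ ↦ rfl
  have he : MapsTo (e : C(X, ↥(range f))) Cᶜ (Subtype.val ⁻¹' (f '' C)ᶜ) := by
    intro x hx hx'
    have hx'' : f x ∈ f '' C := by rwa [← hev]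
    exact mapsTo_compl_image_of_injective hf.injective C hx hx''
  have he' : MapsTo e.symm (Subtype.val ⁻¹' (f '' C)ᶜ) Cᶜ := by
    intro p hp hp'
    exact hp ⟨e.symm p, hp', by rw [← hev, e.apply_symm_apply]⟩
  have hi : MapsTo (subsetIncl (range f)) (Subtype.val ⁻¹' (f '' C)ᶜ) (f '' C)ᶜ :=
    mapsTo_preimage Subtype.val _
  haveI h1 : IsIso (relativeSingularHomology.map R Md (e : C(X, ↥(range f))) he k) :=
    relativeSingularHomology.isIso_map_homeomorph R Md e he he' k
  haveI h2 : IsIso (relativeSingularHomology.map R Md (subsetIncl (range f)) hi k) := by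
    refine relativeSingularHomology.isIso_map_of_interior_union_interior_holds R Md Y (f '' C)ᶜ
      (range f) ?_ k
    rw [hC.isOpen_compl.interior_eq, hf.isOpen_range.interior_eq]
    refine eq_univ_of_forall fun y ↦ ?_
    by_cases hy : y ∈ range f
    · exact Or.inr hy
    · exact Or.inl fun ⟨x, _, hx⟩ ↦ hy ⟨x, hx⟩
  rw [relativeSingularHomology.map_congr_left R Md hfac _ (hi.comp he) k,
    relativeSingularHomology.map_comp R Md (e : C(X, ↥(range f))) (subsetIncl (range f)) he hi k]
  exact IsIso.comp_isIso

end Excision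

section GysinKernel

variable {F : Type v} [Field F] {n : ℕ}
variable {Z M : Type u} [TopologicalSpace Z] [TopologicalSpace M]
  [CompactSpace Z] [T2Space Z] [ChartedSpace (EuclideanSpace ℝ (Fin n)) Z]

/-- **A class killed by the Gysin map of a map which is a local homeomorphism around the compact
subsets of an open set dies on that open set** (over a field). Let `f : Z → M` be a map of closed
oriented `n`-manifolds and `K ⊆ Z` closed such that for every closed `C ⊆ Z ∖ K` the map of pairs
`(Z, Z ∖ C) → (M, M ∖ f(C))` is defined and induces isomorphisms on relative homology (e.g. `f`
restricted to a neighbourhood of `Z ∖ K` is an open embedding whose image meets `f(K)` trivially).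
If `f_! w = 0` then `w` dies on `Z ∖ K`: by the cap-product criterion
(`map_eq_zero_iff_forall_ofAbsolute_capProduct_eq_zero`) it suffices that `w ⌢ [Z] ↦ 0` in each
`H_q(Z, Z ∖ C)`, and its image in the ISOMORPHIC `H_q(M, M ∖ f(C))` is `j_*(f_*(w ⌢ [Z])) =
j_*(f_! w ⌢ [M]) = 0` (`capProduct_gysinMap`). This is the topological core of "`τ_* τ^* = id`
and the pure part of `Hᵏ(U)` comes from any smooth compactification" for a proper modification.
[cite: VoisinHodgeI2002, Thm. 7.31 (proof) and Lemma 7.28] [cite: HatcherAT2002, §3.3 Thm. 3.44 and Thm. 2.20] -/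
theorem map_subsetIncl_compl_eq_zero_of_gysinMap_eq_zero (μZ : HomologicalOrientation F Z n)
    (μM : HomologicalOrientation F M n) (hM : μM.HasPoincareDuality) (f : C(Z, M)) {K : Set Z}
    (hK : IsClosed K)
    (hexc : ∀ C : Set Z, IsClosed C → C ⊆ Kᶜ → ∃ h : MapsTo f Cᶜ (f '' C)ᶜ,
      ∀ q : ℕ, IsIso (relativeSingularHomology.map F F f h q))
    {p q : ℕ} (hpq : p + q = n) (w : singularCohomology F F Z p)
    (hw : gysinMap μZ μM f hpq hpq w = 0) :
    singularCohomology.map F F (subsetIncl Kᶜ) p w = 0 := by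
  rw [map_eq_zero_iff_forall_ofAbsolute_capProduct_eq_zero μZ hK hpq]
  intro C hC hCK
  obtain ⟨h, hiso⟩ := hexc C hC hCK
  haveI := hiso q
  have key : relativeSingularHomology.map F F f h q
      (relativeSingularHomology.ofAbsolute F F Z Cᶜ q (capProduct hpq w μZ.fundamentalClass)) = 0 := by
    rw [← ModuleCat.comp_apply, relativeSingularHomology.ofAbsolute_comp_map, ModuleCat.comp_apply]
    change relativeSingularHomology.ofAbsolute F F M (f '' C)ᶜ q
      (singularHomology.map F F f q (capProduct hpq w μZ.fundamentalClass)) = 0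
    rw [← capProduct_gysinMap hM f hpq hpq w, hw, map_zero, LinearMap.zero_apply, map_zero]
  exact (ConcreteCategory.injective_of_mono_of_preservesPullback
    (relativeSingularHomology.map F F f h q)) (key.trans (map_zero _).symm)

end GysinKernel

end Literature.AlgebraicTopology.SingularHomology

/-! ### Algebraic part: proper modifications of smooth projective complex varieties -/

namespace Literature.AlgebraicGeometry.HodgeTheory

open Literature.AlgebraicGeometry.Motives

variable {n : ℕ} {Z M : Motives.SchemeOver ℂ}

/-- **The pure part of the open piece is reached from the base** (Voisin I, proof of Thm. 7.31, first
step, for a proper modification). Let `b : Z ⟶ M` be a birational morphism of smooth projective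
complex `n`-folds which is an isomorphism over the open `U ⊆ M` (e.g. the blow-up of `M` along a
smooth centre disjoint from `U`, or any composite of such). Then every class `z ∈ Hᵏ(Z(ℂ); ℂ)` is
`b^* y + w` with `w` dying on `(b⁻¹U)(ℂ)` — namely `y = b_! z` (`b` has degree one,
`exists_hasDegree_one_of_isBirational`; `b_! b^* = id`, `gysinMap_map_of_hasDegree`), the class
`w = z - b^* b_! z` being killed by `b_!` and hence dying on `(b⁻¹U)(ℂ)`, over which `b(ℂ)` is a
homeomorphism onto the open `U(ℂ)` (`map_subsetIncl_compl_eq_zero_of_gysinMap_eq_zero` with the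
excisions `relativeSingularHomology.isIso_map_of_isOpenEmbedding` along `(b⁻¹U)(ℂ) ↪ Z(ℂ)` and
`(b⁻¹U)(ℂ) ≅ U(ℂ) ↪ M(ℂ)`, SGA1 XII Prop. 3.1 (xi)). Equivalently: the image of `Hᵏ(Z(ℂ))` in
`Hᵏ((b⁻¹U)(ℂ)) = Hᵏ(U(ℂ))` is the image of `Hᵏ(M(ℂ))` (the pure part of `Hᵏ(U)` does not depend on
the smooth compactification). [cite: VoisinHodgeI2002, Thm. 7.31 (proof) and Lemma 7.28]
[cite: Fulton1998, Lemma 19.1.2] [cite: SGA1, Exp. XII Prop. 3.1 (xi)] -/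
theorem exists_restrictCompl_sub_map_eq_zero_of_isIso_restrict
    (hZ : IsSmoothProjective n Z) (hM : IsSmoothProjective n M) (b : Z ⟶ M)
    (hb : Resolution.IsBirational b.left) (U : M.left.Opens) [IsIso (b.left ∣_ U)]
    (k : ℕ) (z : complexBetti Z k) :
    ∃ y : complexBetti M k,
      complexBetti.restrictCompl Z ((b.left ⁻¹ᵁ U : Set Z.left)ᶜ) k (z - complexBetti.map b k y) = 0 := by
  letI := hZ.chartedSpace
  letI := hM.chartedSpace
  haveI := ComplexPoints.compactSpace_of_isSmoothProjective hZ
  haveI := ComplexPoints.compactSpace_of_isSmoothProjective hM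
  haveI := ComplexPoints.t2Space_of_isSmoothProjective hZ
  haveI := ComplexPoints.t2Space_of_isSmoothProjective hM
  -- degrees above `2n`: everything vanishes
  by_cases hk : 2 * n < k
  · haveI := subsingleton_complexBetti hZ hk
    exact ⟨0, by rw [Subsingleton.elim (z - _) 0, map_zero]⟩
  have hpq : k + (2 * n - k) = 2 * n := by omega
  -- `b` has degree one for suitable orientations
  obtain ⟨μ, ν, hdeg⟩ := exists_hasDegree_one_of_isBirational hZ hM b hb
  have hνPD : ν.HasPoincareDuality := fun p q h ↦ poincare_duality ν h
  set f : C(ComplexPoints Z, ComplexPoints M) := AlgPoints.mapContinuous (L := ℂ) b with hf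
  -- `w = z - b^*(b_! z)` is killed by `b_!`
  refine ⟨gysinMap μ ν f hpq hpq z, ?_⟩
  have hw : gysinMap μ ν f hpq hpq (z - complexBetti.map b k (gysinMap μ ν f hpq hpq z)) = 0 := by
    rw [map_sub]
    change gysinMap μ ν f hpq hpq z -
      gysinMap μ ν f hpq hpq (singularCohomology.map ℂ ℂ f k (gysinMap μ ν f hpq hpq z)) = 0
    rw [gysinMap_map_of_hasDegree hνPD hdeg hpq, one_smul, sub_self]
  -- the closed set `{P | pt P ∉ b⁻¹U}` and the excisions around the closed subsets of its complement
  set V : Z.left.Opens := b.left ⁻¹ᵁ U with hV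
  have hK : IsClosed {P : ComplexPoints Z | P.pt ∈ ((V : Set Z.left))ᶜ} :=
    isClosed_setOf_pt_mem V.2.isClosed_compl
  have hexc : ∀ C : Set (ComplexPoints Z), IsClosed C →
      C ⊆ {P : ComplexPoints Z | P.pt ∈ ((V : Set Z.left))ᶜ}ᶜ →
      ∃ h : MapsTo f Cᶜ (f '' C)ᶜ, ∀ q : ℕ, IsIso (relativeSingularHomology.map ℂ ℂ f h q) := by
    intro C hC hCK
    -- the open pieces `j : V ↪ Z` and `g : V ≅ U ↪ M`, with `b ∘ j = g`
    set j : openSubschemeOver Z V ⟶ Z := openSubschemeOverι Z V with hj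
    set g : openSubschemeOver Z V ⟶ M := restrictOverHom b U ≫ openSubschemeOverι M U with hg
    haveI : IsOpenImmersion j.left := inferInstanceAs (IsOpenImmersion V.ι)
    haveI : IsOpenImmersion (b.left ∣_ U) := inferInstance
    haveI : IsOpenImmersion g.left := by
      change IsOpenImmersion ((b.left ∣_ U) ≫ U.ι)
      infer_instance
    have hjg : j ≫ b = g := (restrictOverHom_comp_openSubschemeOverι b U).symm
    set jC : C(ComplexPoints (openSubschemeOver Z V), ComplexPoints Z) :=
      AlgPoints.mapContinuous (L := ℂ) j with hjC
    set gC : C(ComplexPoints (openSubschemeOver Z V), ComplexPoints M) :=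
      AlgPoints.mapContinuous (L := ℂ) g with hgC
    have hje : IsOpenEmbedding jC := AlgPoints.isOpenEmbedding_map_holds j
    have hge : IsOpenEmbedding gC := AlgPoints.isOpenEmbedding_map_holds g
    have hcomp : ∀ P, f (jC P) = gC P := fun P ↦ by
      change AlgPoints.map b (AlgPoints.map j P) = AlgPoints.map g P
      rw [← AlgPoints.map_comp_apply, hjg]
    -- `range j(ℂ) = {P | pt P ∈ b⁻¹U}`
    have hrange : Set.range jC = {P : ComplexPoints Z | P.pt ∈ ((V : Set Z.left))ᶜ}ᶜ := by
      change Set.range (AlgPoints.map j) = _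
      rw [AlgPoints.range_map_of_isOpenImmersion_holds j]
      ext P
      change P.pt ∈ (j.left.opensRange : Set Z.left) ↔ ¬ (P.pt ∈ ((V : Set Z.left))ᶜ)
      rw [Set.mem_compl_iff, not_not]
      change P.pt ∈ (V.ι.opensRange : Set Z.left) ↔ _
      rw [Scheme.Opens.opensRange_ι]
    -- `C = j(ℂ)(C')`
    obtain ⟨C', rfl⟩ : ∃ C' : Set (ComplexPoints (openSubschemeOver Z V)), jC '' C' = C :=
      ⟨jC ⁻¹' C, Set.image_preimage_eq_of_subset (by rw [hrange]; exact hCK)⟩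
    have hfg : f '' (jC '' C') = gC '' C' := by
      rw [Set.image_image]
      exact Set.image_congr' hcomp
    have hC2 : IsClosed (gC '' C') := by
      rw [← hfg]
      exact (hC.isCompact.image f.continuous).isClosed
    rw [hfg]
    -- `b(ℂ)` is a map of pairs `(Z, Z ∖ C) → (M, M ∖ b(C))`
    have h : MapsTo f (jC '' C')ᶜ (gC '' C')ᶜ := by
      intro Q hQ hQ'
      obtain ⟨P', hP', hPQ⟩ := hQ'
      have hQV : Q ∈ Set.range jC := by
        rw [hrange]
        change ¬ (Q.pt ∈ ((V : Set Z.left))ᶜ)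
        rw [Set.mem_compl_iff, not_not]
        change b.left.base Q.pt ∈ U
        have h1 : (f Q).pt = b.left.base Q.pt := AlgPoints.pt_map b Q
        rw [← h1, ← hPQ]
        change g.left.base P'.pt ∈ U
        have h2 := Set.mem_range_self (f := U.ι.base) ((b.left ∣_ U).base P'.pt)
        rw [Scheme.Opens.range_ι] at h2
        exact h2
      obtain ⟨Q', rfl⟩ := hQV
      have hQP : Q' = P' := hge.injective ((hcomp Q').symm.trans hPQ.symm)
      exact hQ ⟨Q', hQP ▸ hP', rfl⟩
    refine ⟨h, fun q ↦ ?_⟩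
    haveI h1 := relativeSingularHomology.isIso_map_of_isOpenEmbedding ℂ ℂ jC hje hC q
    have h2 := relativeSingularHomology.isIso_map_of_isOpenEmbedding ℂ ℂ gC hge hC2 q
    have hfac : relativeSingularHomology.map ℂ ℂ gC (mapsTo_compl_image_of_injective hge.injective C') q =
        relativeSingularHomology.map ℂ ℂ jC (mapsTo_compl_image_of_injective hje.injective C') q ≫
          relativeSingularHomology.map ℂ ℂ f h q := by
      rw [← relativeSingularHomology.map_comp]
      exact relativeSingularHomology.map_congr_left ℂ ℂ (f := gC) (f' := f.comp jC)
        (by ext P : 1; exact (hcomp P).symm) _ _ q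
    have h3 : IsIso (relativeSingularHomology.map ℂ ℂ jC
        (mapsTo_compl_image_of_injective hje.injective C') q ≫ relativeSingularHomology.map ℂ ℂ f h q) := by
      rw [← hfac]
      exact h2
    exact IsIso.of_isIso_comp_left (relativeSingularHomology.map ℂ ℂ jC
      (mapsTo_compl_image_of_injective hje.injective C') q) _
  exact map_subsetIncl_compl_eq_zero_of_gysinMap_eq_zero μ ν hνPD f hK hexc hpq _ hw

/-! ### Thom–Gysin exactness for finitely many disjoint smooth closed subvarieties -/

section Disjoint

/-- Finitely many pairwise disjoint compact subsets of a Hausdorff space have pairwise disjoint open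
neighbourhoods. [folklore] -/
theorem exists_pairwise_disjoint_isOpen_of_isCompact {T : Type u} [TopologicalSpace T] [T2Space T]
    {ι : Type} [Finite ι] {K : ι → Set T} (hK : ∀ i, IsCompact (K i))
    (hdisj : Pairwise (Disjoint on K)) :
    ∃ W : ι → Set T, (∀ i, IsOpen (W i)) ∧ (∀ i, K i ⊆ W i) ∧ Pairwise (Disjoint on W) := by
  classical
  have hs : ∀ i j, ∃ U V : Set T, i ≠ j → IsOpen U ∧ IsOpen V ∧ K i ⊆ U ∧ K j ⊆ V ∧ Disjoint U V := by
    intro i j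
    by_cases hij : i ≠ j
    · obtain ⟨U, V, hU, hV, hKU, hKV, hUV⟩ :=
        SeparatedNhds.of_isCompact_isCompact (hK i) (hK j) (hdisj hij)
      exact ⟨U, V, fun _ ↦ ⟨hU, hV, hKU, hKV, hUV⟩⟩
    · exact ⟨univ, univ, fun h ↦ absurd h hij⟩
  choose u v huv using hs
  refine ⟨fun i ↦ ⋂ j : {j // j ≠ i}, (u i j ∩ v j i), fun i ↦ ?_, fun i ↦ ?_, fun i j hij ↦ ?_⟩
  · exact isOpen_iInter_of_finite fun j ↦ (huv i j j.2.symm).1.inter (huv j i j.2).2.1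
  · exact subset_iInter fun j ↦ subset_inter (huv i j j.2.symm).2.2.1 (huv j i j.2).2.2.2.1
  · have hi : (⋂ j' : {j' // j' ≠ i}, (u i j' ∩ v j' i)) ⊆ u i j :=
      (iInter_subset _ ⟨j, hij.symm⟩).trans inter_subset_left
    have hj : (⋂ i' : {i' // i' ≠ j}, (u j i' ∩ v i' j)) ⊆ v i j :=
      (iInter_subset _ ⟨i, hij⟩).trans inter_subset_right
    exact Disjoint.mono hi hj (huv i j hij).2.2.2.2

variable {X : Motives.SchemeOver ℂ}

/-- **Thom–Gysin exactness for finitely many pairwise disjoint smooth closed subvarieties**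
(Deligne, Hodge III, Cor. 8.2.8 in this case, unconditionally): for `X` smooth projective of
dimension `n`, closed immersions `g j : Y j ⟶ X` of smooth projective `Y j` with pairwise DISJOINT
images, and every degree `b`,
`ker (Hᵇ(X(ℂ); ℂ) → Hᵇ((X ∖ ⋃ j, g_j(Y j))(ℂ); ℂ)) = Σ_j im ((g j)_* : Hᵃ(Y j(ℂ)) → Hᵇ(X(ℂ)))`.
The Čech hypothesis of `ker_restrictCompl_eq_iSup_range_complexGysin_of_pullback` is verified: a
class killed by every `(g j)(ℂ)^*` vanishes on an open neighbourhood `V j` of each compact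
`{P | pt P ∈ g_j(Y j)}` (tautness, `exists_isOpen_map_subsetIncl_eq_zero_of_isClosedImmersion`);
shrink the `V j` into pairwise disjoint open sets (`exists_pairwise_disjoint_isOpen_of_isCompact`);
over their union, a disjoint open decomposition, a class vanishing on each piece vanishes
(`eq_zero_of_forall_map_subsetIncl_eq_zero`, additivity of cohomology). For ONE closed immersion
this is the tree's `ker_restrictCompl_eq_iSup_range_complexGysin_of_isClosedImmersion`; the exceptional
divisor of the blow-up of `X^{r+1}ₘ × X¹ₘ × W` along `Xʳₘ × X⁰ₘ × W` has `m` components.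
[cite: DeligneHodgeIII1974, Cor. 8.2.8] [cite: VoisinHodgeII2003, §6.1.1 (Thom–Gysin sequence before (6.3))]
[cite: HatcherAT2002, §3.1 p. 202] -/
theorem ker_restrictCompl_eq_iSup_range_complexGysin_of_disjoint (μ : OrientationFamily)
    (hX : IsSmoothProjective n X) {ι : Type} [Finite ι] {m : ι → ℕ}
    {Y : ι → Motives.SchemeOver ℂ} (hY : ∀ j, IsSmoothProjective (m j) (Y j)) (g : ∀ j, Y j ⟶ X)
    [∀ j, IsClosedImmersion (g j).left]
    (hdisj : Pairwise (Disjoint on fun j ↦ Set.range (g j).left.base)) (b : ℕ) :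
    LinearMap.ker (complexBetti.restrictCompl X (⋃ j, Set.range (g j).left.base) b).hom =
      ⨆ (j : ι) (a : ℕ) (hab : a + 2 * n = b + 2 * m j),
        LinearMap.range (complexGysin μ (hY j) hX (g j) hab) := by
  letI := hX.chartedSpace
  haveI := ComplexPoints.compactSpace_of_isSmoothProjective hX
  haveI := ComplexPoints.t2Space_of_isSmoothProjective hX
  refine ker_restrictCompl_eq_iSup_range_complexGysin_of_pullback μ hX hY g b fun q x' _ hx' ↦ ?_
  -- a neighbourhood of each component on which `x'` vanishes
  have hV : ∀ j, ∃ V : Set (ComplexPoints X), IsOpen V ∧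
      {P | P.pt ∈ Set.range (g j).left.base} ⊆ V ∧ singularCohomology.map ℂ ℂ (subsetIncl V) q x' = 0 :=
    fun j ↦ exists_isOpen_map_subsetIncl_eq_zero_of_isClosedImmersion hX (hY j) (g j) x' (hx' j)
  choose V hVo hKV hxV using hV
  -- pairwise disjoint open neighbourhoods of the (compact, pairwise disjoint) components
  have hKc : ∀ j, IsCompact {P : ComplexPoints X | P.pt ∈ Set.range (g j).left.base} :=
    fun j ↦ (isClosed_setOf_pt_mem (g j).left.isClosedEmbedding.isClosed_range).isCompact
  have hKd : Pairwise (Disjoint on fun j ↦ {P : ComplexPoints X | P.pt ∈ Set.range (g j).left.base}) :=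
    fun i j hij ↦ Set.disjoint_left.2 fun P hPi hPj ↦ Set.disjoint_left.1 (hdisj hij) hPi hPj
  obtain ⟨W, hWo, hKW, hWd⟩ := exists_pairwise_disjoint_isOpen_of_isCompact hKc hKd
  -- the union of the shrunk neighbourhoods
  refine ⟨⋃ j, V j ∩ W j, isOpen_iUnion fun j ↦ (hVo j).inter (hWo j), ?_, ?_⟩
  · rintro P ⟨_, ⟨j, rfl⟩, hP⟩
    exact Set.mem_iUnion.2 ⟨j, hKV j hP, hKW j hP⟩
  · -- additivity over the disjoint open decomposition of `⋃ j, V j ∩ W j`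
    have hA : IsClopenPartition (fun j ↦ (Subtype.val ⁻¹' (V j ∩ W j) : Set (↥(⋃ j, V j ∩ W j)))) :=
      IsClopenPartition.of_pairwise_disjoint
        (fun j ↦ ((hVo j).inter (hWo j)).preimage continuous_subtype_val)
        (fun i j hij ↦ Set.disjoint_left.2 fun P hPi hPj ↦
          Set.disjoint_left.1 (hWd hij) hPi.2 hPj.2)
        (Set.eq_univ_of_forall fun P ↦ by
          obtain ⟨j, hj⟩ := Set.mem_iUnion.1 P.2
          exact Set.mem_iUnion.2 ⟨j, hj⟩)
    refine singularCohomology.eq_zero_of_forall_map_subsetIncl_eq_zero hA fun j ↦ ?_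
    let ι' : C(↥(Subtype.val ⁻¹' (V j ∩ W j) : Set (↥(⋃ j, V j ∩ W j))), ↥(V j)) :=
      ⟨fun P ↦ ⟨P.1.1, P.2.1⟩, by fun_prop⟩
    have e : (subsetIncl (⋃ j, V j ∩ W j)).comp
        (subsetIncl (Subtype.val ⁻¹' (V j ∩ W j) : Set (↥(⋃ j, V j ∩ W j)))) =
        (subsetIncl (V j)).comp ι' := by
      ext P
      rfl
    rw [← ModuleCat.comp_apply, ← singularCohomology.map_comp, e, singularCohomology.map_comp,
      ModuleCat.comp_apply, hxV j, map_zero]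

end Disjoint

/-! ### The two combined: the spanning half of the blow-up formula with the exceptional divisor
left undecomposed -/

section Spanning

variable {X : Motives.SchemeOver ℂ}

/-- **The cohomology of a proper modification is spanned by the pull-back and the Gysin images of
the exceptional components** (Voisin I, Thm. 7.31 / Shioda–Katsura Lemma 2.1, spanning half, with
`H*(E)` undecomposed). Let `b : Z ⟶ M` be a birational morphism of smooth projective complex
`n`-folds, an isomorphism over the open `U ⊆ M`, and `jₜ : Eₜ ⟶ Z` finitely many closed immersions
of smooth projective `Eₜ` (dimensions `mₜ`) with pairwise disjoint images covering `Z ∖ b⁻¹U`.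
Then every `z ∈ Hᵏ(Z(ℂ); ℂ)` lies in `b^* Hᵏ(M(ℂ); ℂ) + Σₜ (jₜ)_* H^{k+2mₜ-2n}(Eₜ(ℂ); ℂ)`:
`z - b^*(b_! z)` dies on `(b⁻¹U)(ℂ)` (`exists_restrictCompl_sub_map_eq_zero_of_isIso_restrict`),
i.e. off `⋃ₜ jₜ(Eₜ)`, hence is a sum of Gysin images
(`ker_restrictCompl_eq_iSup_range_complexGysin_of_disjoint`).
[cite: VoisinHodgeI2002, Thm. 7.31 (proof)] [cite: ShiodaKatsura1979, §2 Lemma 2.1]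
[cite: DeligneHodgeIII1974, Cor. 8.2.8] -/
theorem mem_range_map_sup_iSup_range_complexGysin_of_isIso_restrict (μ : OrientationFamily)
    (hZ : IsSmoothProjective n Z) (hM : IsSmoothProjective n M) (b : Z ⟶ M)
    (hb : Resolution.IsBirational b.left) (U : M.left.Opens) [IsIso (b.left ∣_ U)]
    {ι : Type} [Finite ι] {m : ι → ℕ} {E : ι → Motives.SchemeOver ℂ}
    (hE : ∀ t, IsSmoothProjective (m t) (E t)) (j : ∀ t, E t ⟶ Z) [∀ t, IsClosedImmersion (j t).left]
    (hdisj : Pairwise (Disjoint on fun t ↦ Set.range (j t).left.base))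
    (hcov : ((b.left ⁻¹ᵁ U : Set Z.left))ᶜ = ⋃ t, Set.range (j t).left.base)
    (k : ℕ) (z : complexBetti Z k) :
    z ∈ LinearMap.range (complexBetti.map b k).hom ⊔
      ⨆ (t : ι) (a : ℕ) (hab : a + 2 * n = k + 2 * m t),
        LinearMap.range (complexGysin μ (hE t) hZ (j t) hab) := by
  obtain ⟨y, hy⟩ := exists_restrictCompl_sub_map_eq_zero_of_isIso_restrict hZ hM b hb U k z
  rw [hcov] at hy
  have hmem : z - complexBetti.map b k y ∈
      LinearMap.ker (complexBetti.restrictCompl Z (⋃ t, Set.range (j t).left.base) k).hom := hy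
  rw [ker_restrictCompl_eq_iSup_range_complexGysin_of_disjoint μ hZ hE j hdisj k] at hmem
  have hz : z = complexBetti.map b k y + (z - complexBetti.map b k y) := by abel
  rw [hz]
  exact Submodule.add_mem_sup ⟨y, rfl⟩ hmem

end Spanning

end Literature.AlgebraicGeometry.HodgeTheory
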